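import Literature.Topology.FourManifolds.DehnSurgery
import Literature.Topology.FourManifolds.ConnectedSumTransportProofs
import HarnessLib

/-!
# Transport of integral Dehn surgeries along diffeomorphisms (proofs)

Sibling proofs file of `DehnSurgery`. The theorem `Literature.Topology.FourManifolds.IsIntegralSurgery.of_diffeomorph` there
carries the named fact `Literature.Topology.FourManifolds.IsOpenGluing.of_diffeomorph` (file `ConnectedSum`) as an explicit
hypothesis `hdiff`, instantiated at the models `IY`, `IY'` of the surgered manifolds `Y`, `Y'`.
That fact is false for two unrelated models (formal refutation: file `OpenGluingCounterexample`),
but its instances with `range IY' = range IY` are true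
(`Literature.Topology.FourManifolds.IsOpenGluing.of_diffeomorph_holds_of_range_eq`, file `ConnectedSumTransportProofs`), which
yields the hypothesis-free transport of surgeries below for such models (in particular `IY' = IY`,
or both boundaryless — the closed `3`-manifolds of Rolfsen and Gompf–Stipsicz). Everything here is a
theorem; no statement of `DehnSurgery.lean` is changed:

* `Literature.IsIntegralSurgery.of_diffeomorph_of_range_eq h e hI`,
  `Literature.IsIntegralSurgery.of_diffeomorph_of_boundaryless h e`.

## References
* A. Kosinski, *Differential Manifolds*, Academic Press (1993), Ch. VI §1, proof of Thm (1.1)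
  (smooth structures on gluings are transported along diffeomorphisms).
  [cite: Kosinski1993, Ch. VI §1]
* D. Rolfsen, *Knots and Links* (1976), §9.F. [cite: Rolfsen1976, §9.F]
-/

open scoped Manifold ContDiff Topology
open Set

noncomputable section

namespace Literature.Topology.FourManifolds

variable {EY HY : Type*} [NormedAddCommGroup EY] [NormedSpace ℝ EY] [TopologicalSpace HY]
  {IY : ModelWithCorners ℝ EY HY} {Y : Type*} [TopologicalSpace Y] [ChartedSpace HY Y]
  {HY' : Type*} [TopologicalSpace HY'] {IY' : ModelWithCorners ℝ EY HY'} {Y' : Type*}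
  [TopologicalSpace Y'] [ChartedSpace HY' Y']

/-- **Surgery is transported along diffeomorphisms** `e : Y ≃ₘ⟮IY, IY'⟯ Y'` of the surgered
manifold onto a `C^∞` manifold `Y'` whose model has the same range as `IY` (in particular
`IY' = IY`, or both boundaryless): `IsIntegralSurgery.of_diffeomorph` fed with the true instance
`IsOpenGluing.of_diffeomorph_holds_of_range_eq hI` of its hypothesis `hdiff` (Kosinski,
*Differential Manifolds*, VI.1, proof of Thm 1.1: transport of open gluings). [folklore] -/
theorem IsIntegralSurgery.of_diffeomorph_of_range_eq [IsManifold IY ∞ Y] [IsManifold IY' ∞ Y']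
    {K : Knot} {m : ℤ} (h : IsIntegralSurgery IY Y K m) (e : Y ≃ₘ⟮IY, IY'⟯ Y')
    (hI : range IY' = range IY) : IsIntegralSurgery IY' Y' K m :=
  IsIntegralSurgery.of_diffeomorph (IsOpenGluing.of_diffeomorph_holds_of_range_eq hI) h e

/-- Surgery is transported along diffeomorphisms between manifolds with boundaryless models
(e.g. `𝓡 3` on both sides: closed `3`-manifolds). [folklore] -/
theorem IsIntegralSurgery.of_diffeomorph_of_boundaryless [IY.Boundaryless] [IY'.Boundaryless]
    [IsManifold IY ∞ Y] [IsManifold IY' ∞ Y'] {K : Knot} {m : ℤ} (h : IsIntegralSurgery IY Y K m)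
    (e : Y ≃ₘ⟮IY, IY'⟯ Y') : IsIntegralSurgery IY' Y' K m :=
  h.of_diffeomorph_of_range_eq e (by rw [IY.range_eq_univ, IY'.range_eq_univ])

end Literature.Topology.FourManifolds
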